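import Literature.NumberTheory.GelbartRogawski1991.LocalDoubledRationalSimilitudeSymplectic
import Literature.NumberTheory.GelbartRogawski1991.LocalSplittingCMScaleTransport
import Literature.NumberTheory.GelbartRogawski1991.LocalKudlaSplittingRigiditySplit
import Literature.NumberTheory.GelbartRogawski1991.LocalLineIsometryRigidity
import HarnessLib

/-!
# Kudla rigidity under a RATIONAL SIMILITUDE: the conjugate of the doubled CM section along `Ad(k ⊕ k)` is the scale transport at the multiplier

Topic `NumberTheory/GelbartRogawski1991`; namespace `Literature.NumberTheory.GelbartRogawski1991.UnitaryDualPair.LocalSplitting`.  KERNEL ONLY: theorems;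
no definition, no named fact, no `sorry`.  Cell `hodgecm-mathlib` (D-0151), programme P5 (crux HLiu418 = stmt-HodgeConjecture-24832), piece **P3c** of the road
card `F0/P5/A-p18/g23/ROAD-L4if-v2.A-p18g23.md` §4 (A-p18 (g23), 2026-08-31): the DOUBLED-LEVEL core of step (M3) «`θ_{λ,a}^{Ad k} ≅ θ_{λ,m₀a}`», the exact
analogue of ★ P1 `localSplittingDatumCM_comp_localPiGalConj_eq_scaleTransportSection` with the Galois conjugation replaced by `Ad(KD)`, `KD = (k₀ ⊕ k₀) ⊗ 1`,
`k₀ ∈ GL_n(L⁺)` a rational similitude of `T₀` with multiplier `m₀` (`ᵗk₀ T₀ k₀ = m₀ T₀`).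

THE MATHEMATICS ([Kudla1994, §3 Thm 3.1]; [GelbartRogawski1991, §3.1 Remark p. 457 L4–13]; [MoeglinVignerasWaldspurger1987, Chap. 3 I.1–I.3]).  Let `Σ_χ` be the
`P_Δ`-normalised doubled CM section of `H(L⁺_v) = U(T₀ ⊕ −T₀)(L⁺_v)` (★ `localSplittingDatumCM`), `Σ′_χ` the one for `T₀′ = m₀ T₀`, and `P̃ ∈ S̃p(𝕎^𝔻_v)` any lift
of the symplectic element `P = Res(KD_v) ∘ e′_{m₀}⁻¹` of ★ P3b.  Then **`P̃⁻¹ · Σ_χ(KD g KD⁻¹) · P̃ = scaleTransport_{m₀}(Σ′_χ)(g)`** for every `g ∈ H(L⁺_v)`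
(`localSplittingDatumCM_localCongr_kd_eq_scaleTransportSection`): both sides are sections over `ι^𝔻_{δ/m₀}` (★ P3b `conj_iota_lineDelta_eq_iota_localCongr_kd`,
★ `proj_scaleTransportSection`), both satisfy Kudla's parabolic normalisation in operator form with the SAME scalar `c(p) = χ(det_Δ p)⁻¹ ∏|det_Δ p|^{1/2}`
(★ `parabolic_toRep_conj_scaleTransport_localSplittingDatumCM`; ★ `parabolic_toRep_conj_localSplittingDatumCM` at `KD p KD⁻¹ ∈ P_Δ` with ★ P3a
`isSiegelDelta_localCongr_kd_iff` / `chiDet_localCongr_kd` / `norm_detDelta_localCongr_kd`, transported through `P̃⁻¹` by ★ `parabolic_toRep_conj_conj` since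
`P⁻¹ ℓ_Δ = ℓ_Δ`), every character of `H(L⁺_v)` trivial on `P_Δ` is trivial (★ `eq_one_of_forall_isSiegelDelta_eq_one'`, `T₀` diagonal), so the rigidity
★ `eq_of_parabolic_toRep_conj_eq` identifies them.  NO character is left over: `Ad(KD)` does not move `χ`.
Nothing of the cited sources is asserted; HC_CM is proved only modulo the printed citations until rung 0 closes.

## References
* [Kudla1994] S. Kudla, Israel J. Math. 87 (1994), §3 Thm. 3.1.
* [HarrisKudlaSweet1996] M. Harris, S. Kudla, W. Sweet, J. AMS 9 (1996), §1 (1.11)–(1.16).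
* [GelbartRogawski1991] S. Gelbart, J. Rogawski, Invent. Math. 105 (1991), §3.1 Prop. 3.1.1 p. 455, Remark p. 457 L4–13.
* [MoeglinVignerasWaldspurger1987] LNM 1291 (1987), Chap. 2 II.1, Chap. 3 I.1–I.3.
-/

set_option autoImplicit false
-- buildfix G11b-3 recipe (LEDGER B13-1/B13-3), as in the GelbartRogawski1991 siblings: elaborate sequentially.
set_option Elab.async false

noncomputable section

open scoped Matrix
open NumberField IsDedekindDomain MeasureTheory Matrix
open Literature.RepresentationTheory.HeisenbergGroup
open Literature.NumberTheory.Automorphic Literature.NumberTheory.Automorphic.UnitaryGroup Literature.NumberTheory.Weil1964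
open Literature.NumberTheory.GaloisRepresentations Literature.RepresentationTheory.HarrisKudlaSweet1996

namespace Literature.NumberTheory.GelbartRogawski1991.UnitaryDualPair.LocalSplitting

/-! ## §1 Plumbing: `P ℓ_Δ = ℓ_Δ ⇒ P⁻¹ ℓ_Δ = ℓ_Δ` -/

section Plumbing

variable (F : Type) [Field F] [NumberField F] (v : HeightOneSpectrum (𝓞 F)) (n : ℕ) {T : Matrix (Fin (n + n)) (Fin (n + n)) F}

/-- if `P ℓ_Δ = ℓ_Δ` then `P⁻¹ ℓ_Δ = ℓ_Δ`. [cite: HarrisKudlaSweet1996, §1 (1.11)] -/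
theorem map_deltaLagrangian_inv_of_map_eq (P : LocalSp F (n + n) T v)
    (hP : (deltaLagrangian F v n).map (toLin F v P) = deltaLagrangian F v n) :
    (deltaLagrangian F v n).map (toLin F v P⁻¹) = deltaLagrangian F v n := by
  have h1 : (toLin F v P⁻¹).comp (toLin F v P) = LinearMap.id := by
    refine LinearMap.ext fun x => ?_
    change ((P⁻¹ * P : LocalSp F (n + n) T v) : ((Fin (n + n) → v.adicCompletion F) × (Fin (n + n) → v.adicCompletion F)) ≃ₗ[v.adicCompletion F]
      ((Fin (n + n) → v.adicCompletion F) × (Fin (n + n) → v.adicCompletion F))) x = x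
    rw [inv_mul_cancel]
    rfl
  conv_lhs => rw [← hP, ← Submodule.map_comp, h1, Submodule.map_id]

end Plumbing

/-! ## §1b The conjugated section lies over `ι^𝔻_{δ/m₀}` -/

section Proj

variable (F : Type) [Field F] [NumberField F] (E : Type) [Field E] [NumberField E] [Algebra F E] [Algebra.IsQuadraticExtension F E]
  (c : E ≃ₐ[F] E) (v : HeightOneSpectrum (𝓞 F)) (n : ℕ)
  {δ : E} (hcδ : c δ = -δ) (hδ : δ ≠ 0) {d : F} (hd : δ * δ = algebraMap F E d)
  {T₀ T₀' : Matrix (Fin n) (Fin n) F} (hT₀ : T₀.IsSymm) (hT₀' : T₀'.IsSymm) (m₀ : Fˣ) (hTT₀ : T₀' = (m₀ : F) • T₀)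
  {JD JD' : Matrix (Fin (n + n)) (Fin (n + n)) E} (hJD : JD = (gramD F n T₀).map (algebraMap F E))
  (hJD' : JD' = (gramD F n T₀').map (algebraMap F E))
  (k₀ : GL (Fin n) F) {KD : GL (Fin (n + n)) E}
  (hKD : KD = Matrix.GeneralLinearGroup.map (algebraMap F E) (UnitaryGroup.reindexGL (e₂ n) (UnitaryGroup.blockDiagGL (k₀, k₀))))
  {a : E} (ha : a ≠ 0) (hKDJ : formCongr (c : E →+* E) KD (a • JD) = JD)

include hT₀' hTT₀ hJD' in
set_option maxHeartbeats 2000000 in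
/-- **`π(P̃⁻¹ Σ(KD g KD⁻¹) P̃) = ι^𝔻_{δ/m₀}(g)`** for a section `Σ` over `ι^𝔻_δ` and a lift `P̃` of `P = Res(KD_v) ∘ e′_{m₀}⁻¹` (★ P3b
`conj_iota_lineDelta_eq_iota_localCongr_kd`). [cite: MoeglinVignerasWaldspurger1987, Chap. 3 I.1–I.3] [cite: Kudla1994, §3] -/
theorem proj_conj_localCongr_kd_eq_iota (Psp : LocalSp F (n + n) (gramD F n T₀) v)
    (hPsp : ((Psp : LocalSp F (n + n) (gramD F n T₀) v) : ((Fin (n + n) → v.adicCompletion F) × (Fin (n + n) → v.adicCompletion F)) ≃ₗ[v.adicCompletion F]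
          ((Fin (n + n) → v.adicCompletion F) × (Fin (n + n) → v.adicCompletion F))) =
      (lineScale (unitAt F m₀ v)).symm ≪≫ₗ (isQuadraticCoordinates_local E v c hcδ hδ hd).resAut (Fin (n + n)) (toLocalGL E v KD))
    (P : LocalMp F (n + n) (gramD F n T₀) v) (hP : MpPsi.proj _ P = Psp)
    (S₀ : UnitaryGroup.localPi E c (n + n) JD v →* LocalMp F (n + n) (gramD F n T₀) v)
    (hS₀ : ∀ h, MpPsi.proj _ (S₀ h) = iota F E c (n + n) hcδ hδ hd (gramD F n T₀) (gramD_isSymm F n hT₀) hJD v h)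
    (g : UnitaryGroup.localPi E c (n + n) JD v) :
    MpPsi.proj _ (P⁻¹ * S₀ (localCongr E c KD ha hKDJ v g) * P) =
      iota F E c (n + n) (conj_lineDelta hcδ m₀) (lineDelta_ne_zero hδ m₀) (lineDelta_mul_self hd m₀) (gramD F n T₀) (gramD_isSymm F n hT₀) hJD v g := by
  have key := conj_iota_lineDelta_eq_iota_localCongr_kd F E c v n hcδ hδ hd hT₀ hT₀' m₀ hTT₀ hJD hJD' ha hKDJ Psp hPsp g
  have h1 : MpPsi.proj _ (P⁻¹ * S₀ (localCongr E c KD ha hKDJ v g) * P) = Psp⁻¹ * MpPsi.proj _ (S₀ (localCongr E c KD ha hKDJ v g)) * Psp := by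
    rw [map_mul, map_mul, map_inv, hP]
  rw [h1, hS₀, ← key]
  simp only [mul_assoc, inv_mul_cancel, mul_one, inv_mul_cancel_left]

end Proj

/-! ## §2 The rigidity transport along `Ad(KD)` -/

section CM

variable (L : Type) [Field L] [NumberField L] [IsCMField L] (v : HeightOneSpectrum (𝓞 (maximalRealSubfield L)))
  [MeasurableSpace (v.adicCompletion (maximalRealSubfield L))] [BorelSpace (v.adicCompletion (maximalRealSubfield L))]
  (μ : Measure (v.adicCompletion (maximalRealSubfield L))) [μ.IsAddHaarMeasure]
  (n : ℕ) {T₀ T₀' : Matrix (Fin n) (Fin n) (maximalRealSubfield L)}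

set_option synthInstance.maxHeartbeats 400000 in
set_option maxHeartbeats 4000000 in
/-- **KUDLA RIGIDITY UNDER THE RATIONAL SIMILITUDE `Ad(KD)` (doubled level).**  For a diagonal invertible `T₀`, `k₀ ∈ GL_n(L⁺)` with `ᵗk₀ T₀ k₀ = m₀ T₀`,
`T₀′ = m₀ T₀`, `KD = (k₀ ⊕ k₀) ⊗ 1`, a splitting Hecke character `χ`, any lift `P̃` of `P = Res(KD_v) ∘ e′_{m₀}⁻¹` and any mover `m` of `ℓ_Δ` onto `ℓ_Y`:
`P̃⁻¹ · Σ_χ(KD g KD⁻¹) · P̃ = scaleTransportSection_{m₀}(Σ′_χ)(g)` for all `g ∈ H(L⁺_v)` — both sides are `P_Δ`-normalised sections over `ι^𝔻_{δ/m₀}` with the same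
scalar. [cite: Kudla1994, §3 Thm 3.1] [cite: HarrisKudlaSweet1996, §1 (1.16)] [cite: GelbartRogawski1991, §3.1 Remark p. 457 L4–13]
[cite: MoeglinVignerasWaldspurger1987, Chap. 3 I.1–I.3] -/
theorem localSplittingDatumCM_localCongr_kd_eq_scaleTransportSection (hn : 0 < n)
    (t : Fin n → maximalRealSubfield L) (hT₀t : T₀ = Matrix.diagonal t) (hT₀ : T₀.IsSymm) (hT₀d : IsUnit T₀.det)
    (hT₀' : T₀'.IsSymm) (hT₀'d : IsUnit T₀'.det) (m₀ : (maximalRealSubfield L)ˣ) (hTT₀ : T₀' = (m₀ : maximalRealSubfield L) • T₀)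
    (k₀ : GL (Fin n) (maximalRealSubfield L)) {KD : GL (Fin (n + n)) L}
    (hKD : KD = Matrix.GeneralLinearGroup.map (algebraMap (maximalRealSubfield L) L)
      (UnitaryGroup.reindexGL (e₂ n) (UnitaryGroup.blockDiagGL (k₀, k₀))))
    {a : L} (ha : a ≠ 0)
    (hKDJ : formCongr ((IsCMField.complexConj L : L ≃ₐ[maximalRealSubfield L] L) : L →+* L) KD
      (a • (gramD (maximalRealSubfield L) n T₀).map (algebraMap (maximalRealSubfield L) L)) =
        (gramD (maximalRealSubfield L) n T₀).map (algebraMap (maximalRealSubfield L) L))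
    (χ : HeckeCharacter L) (hχ : IsSplittingChar L 1 χ)
    (Psp : LocalSp (maximalRealSubfield L) (n + n) (gramD (maximalRealSubfield L) n T₀) v)
    (hPsp : ((Psp : LocalSp (maximalRealSubfield L) (n + n) (gramD (maximalRealSubfield L) n T₀) v) :
        ((Fin (n + n) → v.adicCompletion (maximalRealSubfield L)) × (Fin (n + n) → v.adicCompletion (maximalRealSubfield L))) ≃ₗ[v.adicCompletion (maximalRealSubfield L)]
          ((Fin (n + n) → v.adicCompletion (maximalRealSubfield L)) × (Fin (n + n) → v.adicCompletion (maximalRealSubfield L)))) =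
      (lineScale (unitAt (maximalRealSubfield L) m₀ v)).symm ≪≫ₗ
        (isQuadraticCoordinates_local L v (IsCMField.complexConj L) (complexConj_imagUnit L) (imagUnit_ne_zero L) (imagUnit_mul_self L)).resAut
          (Fin (n + n)) (toLocalGL L v KD))
    (P : LocalMp (maximalRealSubfield L) (n + n) (gramD (maximalRealSubfield L) n T₀) v) (hP : MpPsi.proj _ P = Psp)
    (m : LocalMp (maximalRealSubfield L) (n + n) (gramD (maximalRealSubfield L) n T₀) v)
    (hm : (deltaLagrangian (maximalRealSubfield L) v n).map (toLin (maximalRealSubfield L) v (MpPsi.proj _ m)) =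
      lagrangianY (maximalRealSubfield L) (n + n) v)
    (g : UnitaryGroup.localPi L (IsCMField.complexConj L) (n + n) ((gramD (maximalRealSubfield L) n T₀).map (algebraMap (maximalRealSubfield L) L)) v) :
    P⁻¹ * (localSplittingDatumCM L v μ n hT₀ hT₀d rfl χ hχ).localSplitting (localCongr L (IsCMField.complexConj L) KD ha hKDJ v g) * P =
      scaleTransportSection (maximalRealSubfield L) L (IsCMField.complexConj L) (n + n) (complexConj_imagUnit L) (imagUnit_ne_zero L)
        (imagUnit_mul_self L) (gramD (maximalRealSubfield L) n T₀) (gramD (maximalRealSubfield L) n T₀')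
        (gramD_isSymm (maximalRealSubfield L) n hT₀) (gramD_isSymm (maximalRealSubfield L) n hT₀') m₀
        (gramD_of_eq_smul (maximalRealSubfield L) m₀ hTT₀) rfl rfl v
        (localSplittingDatumCM L v μ n hT₀' hT₀'d rfl χ hχ).localSplitting
        (localSplittingDatumCM L v μ n hT₀' hT₀'d rfl χ hχ).proj_localSplitting g := by
  -- the conjugated section as a homomorphism `S g := P⁻¹ Σ(KD g KD⁻¹) P`
  let S : UnitaryGroup.localPi L (IsCMField.complexConj L) (n + n) ((gramD (maximalRealSubfield L) n T₀).map (algebraMap (maximalRealSubfield L) L)) v →*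
      LocalMp (maximalRealSubfield L) (n + n) (gramD (maximalRealSubfield L) n T₀) v :=
    MonoidHom.mk' (fun g => P⁻¹ * (localSplittingDatumCM L v μ n hT₀ hT₀d rfl χ hχ).localSplitting
        (localCongr L (IsCMField.complexConj L) KD ha hKDJ v g) * P)
      (fun g h => by simp only [map_mul, mul_assoc, mul_inv_cancel_left])
  have hS : ∀ g, S g = P⁻¹ * (localSplittingDatumCM L v μ n hT₀ hT₀d rfl χ hχ).localSplitting
      (localCongr L (IsCMField.complexConj L) KD ha hKDJ v g) * P := fun _ => rfl
  rw [← hS]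
  -- abbreviations for the two trace-zero readings
  have hcδ' := conj_lineDelta (complexConj_imagUnit L) m₀
  have hδ' := lineDelta_ne_zero (imagUnit_ne_zero L) m₀
  have hd' := lineDelta_mul_self (imagUnit_mul_self L) m₀
  -- the symplectic element `π(P)` preserves `ℓ_Δ`, hence so does `π(P⁻¹) = π(P)⁻¹`
  have hPΔ : (deltaLagrangian (maximalRealSubfield L) v n).map (toLin (maximalRealSubfield L) v (MpPsi.proj _ P)) =
      deltaLagrangian (maximalRealSubfield L) v n :=
    hP ▸ map_deltaLagrangian_symplectic_kd (maximalRealSubfield L) L (IsCMField.complexConj L) v n (complexConj_imagUnit L) (imagUnit_ne_zero L)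
      (imagUnit_mul_self L) m₀ k₀ hKD Psp hPsp
  have hPΔ' : (deltaLagrangian (maximalRealSubfield L) v n).map (toLin (maximalRealSubfield L) v (MpPsi.proj _ P⁻¹)) =
      deltaLagrangian (maximalRealSubfield L) v n := by
    rw [map_inv]
    exact map_deltaLagrangian_inv_of_map_eq (maximalRealSubfield L) v n _ hPΔ
  have hmain : S = scaleTransportSection (maximalRealSubfield L) L (IsCMField.complexConj L) (n + n) (complexConj_imagUnit L) (imagUnit_ne_zero L)
        (imagUnit_mul_self L) (gramD (maximalRealSubfield L) n T₀) (gramD (maximalRealSubfield L) n T₀')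
        (gramD_isSymm (maximalRealSubfield L) n hT₀) (gramD_isSymm (maximalRealSubfield L) n hT₀') m₀
        (gramD_of_eq_smul (maximalRealSubfield L) m₀ hTT₀) rfl rfl v
        (localSplittingDatumCM L v μ n hT₀' hT₀'d rfl χ hχ).localSplitting
        (localSplittingDatumCM L v μ n hT₀' hT₀'d rfl χ hχ).proj_localSplitting := by
    refine eq_of_parabolic_toRep_conj_eq (maximalRealSubfield L) L (IsCMField.complexConj L) hcδ' hδ' hd' v n hT₀ hT₀d rfl _ _ ?_ ?_
      (fun p => (((chiDet (maximalRealSubfield L) L (IsCMField.complexConj L) v n (fun w' : PlacesOver L v => (χ.localComponent w'.1)⁻¹) p)⁻¹ : ℂˣ) : ℂ) *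
        ((∏ w' : PlacesOver L v, Real.sqrt ‖detDelta (maximalRealSubfield L) L (IsCMField.complexConj L) v n w' p‖ : ℝ) : ℂ)) ?_ m ?_ ?_
    · -- (i) equal projections: `π(P)⁻¹ ι_δ(KD g KD⁻¹) π(P) = ι_{δ/m₀}(g)`
      intro g
      rw [hS, proj_scaleTransportSection]
      exact proj_conj_localCongr_kd_eq_iota (maximalRealSubfield L) L (IsCMField.complexConj L) v n (complexConj_imagUnit L) (imagUnit_ne_zero L)
        (imagUnit_mul_self L) hT₀ hT₀' m₀ hTT₀ rfl rfl ha hKDJ Psp hPsp P hP _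
        (localSplittingDatumCM L v μ n hT₀ hT₀d rfl χ hχ).proj_localSplitting g
    · -- (iv) characters trivial on `P_Δ` are trivial
      exact fun θ hθ => eq_one_of_forall_isSiegelDelta_eq_one' (maximalRealSubfield L) L (IsCMField.complexConj L) hcδ' hδ' hd' v n hn t hT₀t hT₀ hT₀d rfl θ hθ
    · -- the scalar does not vanish on `P_Δ`
      intro p hp
      refine mul_ne_zero (Units.ne_zero _) ?_
      rw [Complex.ofReal_ne_zero]
      refine Finset.prod_ne_zero_iff.2 fun w' _ => ?_
      rw [Real.sqrt_ne_zero (norm_nonneg _), norm_ne_zero_iff]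
      exact detDelta_ne_zero (maximalRealSubfield L) L (IsCMField.complexConj L) hcδ' hδ' hd' v n hT₀ rfl hp w'
    · -- (iii-a) the scale-transported section is normalised with the scalar
      intro p hp Φ
      exact parabolic_toRep_conj_scaleTransport_localSplittingDatumCM L v μ n m₀ hT₀ hT₀' hT₀'d
        (gramD_of_eq_smul (maximalRealSubfield L) m₀ hTT₀) χ hχ m hm p hp Φ
    · -- (iii-b) the conjugated section `P⁻¹ Σ(KD · KD⁻¹) P` is normalised with the same scalar (★ `parabolic_toRep_conj_conj` at `P⁻¹`)
      intro p hp Φ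
      have hconj := parabolic_toRep_conj_conj (maximalRealSubfield L) L (IsCMField.complexConj L) v n (complexConj_imagUnit L) (imagUnit_ne_zero L)
        (imagUnit_mul_self L) hcδ' hδ' hd' hT₀ rfl
        ((localSplittingDatumCM L v μ n hT₀ hT₀d rfl χ hχ).localSplitting.comp
          (MonoidHom.mk' (fun g => localCongr L (IsCMField.complexConj L) KD ha hKDJ v g) fun g h => map_mul _ g h))
        (fun p => (((chiDet (maximalRealSubfield L) L (IsCMField.complexConj L) v n (fun w' : PlacesOver L v => (χ.localComponent w'.1)⁻¹) p)⁻¹ : ℂˣ) : ℂ) *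
          ((∏ w' : PlacesOver L v, Real.sqrt ‖detDelta (maximalRealSubfield L) L (IsCMField.complexConj L) v n w' p‖ : ℝ) : ℂ))
        ?_ P⁻¹ hPΔ' m hm p hp Φ
      · rw [inv_inv] at hconj
        rw [hS]
        exact hconj
      · -- the normalisation of `Σ ∘ Ad(KD)` for every mover: `KD p KD⁻¹ ∈ P_Δ` with the same `det_Δ` data
        intro m' hm' p' hp' Φ'
        have hAd : IsSiegelDelta (maximalRealSubfield L) L (IsCMField.complexConj L) (complexConj_imagUnit L) (imagUnit_ne_zero L) (imagUnit_mul_self L) v n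
            hT₀ rfl (localCongr L (IsCMField.complexConj L) KD ha hKDJ v p') :=
          (isSiegelDelta_localCongr_kd_iff (maximalRealSubfield L) L (IsCMField.complexConj L) v n rfl k₀ rfl hKD ha hKDJ (complexConj_imagUnit L)
            (imagUnit_ne_zero L) (imagUnit_mul_self L) hT₀ p').2 hp'
        rw [MonoidHom.comp_apply, MonoidHom.mk'_apply, parabolic_toRep_conj_localSplittingDatumCM L v μ n hT₀ hT₀d rfl χ hχ m' hm' _ hAd Φ',
          chiDet_localCongr_kd (maximalRealSubfield L) L (IsCMField.complexConj L) v n k₀ rfl hKD ha hKDJ]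
        congr 2
        push_cast
        exact Finset.prod_congr rfl fun w' _ => by
          rw [norm_detDelta_localCongr_kd (maximalRealSubfield L) L (IsCMField.complexConj L) v n k₀ rfl hKD ha hKDJ]
  exact DFunLike.congr_fun hmain _

end CM

end Literature.NumberTheory.GelbartRogawski1991.UnitaryDualPair.LocalSplitting

end
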